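import Summits.BirchSwinnertonDyer.Rank1Residual.GaloisImage.ThreeAdicTowerInertiaCriterion
import HarnessLib

/-!
# The SCALAR-STABILISER socket at level `9`: if a scalar-closed set `C ⊆ E[9]` has an `H`-orbit of
# size divisible by `9`, some element of `H` is trivial on `E[3]` and non-scalar on `E[9]` — hence
# the `3`-adic tower from surj(3)
# (cell `b2b-bsdres`, team n1011, seat p02 gen 5 — row T-b11-F4 'scalar-stabiliser tower criterion',
# file F4b; pure group theory over the gen-2 sockets p252833 / p254468, no reduction hypothesis)

HONEST FRAMING (cell `b2b-bsdres`, run/shared/lean/b2b/bsd-rank1-residual/, verbatim in every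
file): the goal of the cell is to DELETE the COMBINATION-SHAPED residual classes of the
Birch–Swinnerton-Dyer formula for ALL analytic-rank `≤ 1` elliptic curves over `ℚ` — "full BSD
formula for every rank `≤ 1` curve in class `C`" assembled STRICTLY from published theorems — so
that the rank-`≤ 1` remainder becomes exactly the CONSTRUCTION-SHAPED classes, which are TYPED
(missing-input `Prop`s), NOT attempted. This is not "finishing BSD". Team n1011 (N10 / N11):
research route; no claim beyond the stated classes; labels UNCHANGED; nothing is booked. Theorems
only (no definition, no named fact).

## What this file proves

Let `E = W/ℚ`, `H ≤ Γ_ℚ` (in practice an inertia group `I_𝔓` at a prime over `3`) and let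
`C ⊆ E[9]` be a set of geometric points closed under the scalars `(1 + 3m)·` (e.g. any subgroup of
`E[9]`, in particular a cyclic subgroup of order `9`).  Write `Stab C ≤ Γ_ℚ` for its set-wise
stabiliser (`MulAction.stabilizer`, pointwise action on sets).

* `inf_ker_le_stabilizer_of_forall_scalar` (§1) — if every element of `H ∩ ker ρ̄_{E,3}` acts on
  `E[9]` as a scalar `(1 + 3m)·`, then `H ∩ ker ρ̄_{E,3} ≤ Stab C` (such an element and its inverse
  map `C` into `C`).
* `relIndex_stabilizer_dvd_card_map_three_of_forall_scalar` (§1) — then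
  `[H : H ∩ Stab C] ∣ #ρ̄_{E,3}(H)` (`Subgroup.relIndex_dvd_of_le_left`, `relIndex_ker`), and
  `#ρ̄_{E,3}(H) ∣ 48`.
* **`exists_mem_fixing_three_not_scalar_nine_of_nine_dvd_relIndex_stabilizer`** (§2, the SOCKET) —
  if `9 ∣ [H : H ∩ Stab C]` (the `H`-orbit of `C` has size divisible by `9`), some `s ∈ H` fixes
  `E[3]` pointwise and is NOT a scalar `(1 + 3m)·` on `E[9]` (`9 ∤ 48`).
* `towerSurj_three_of_surj_of_nine_dvd_relIndex_stabilizer` (§2) — with `ρ̄_{E,3}` onto, then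
  `ρ̄_{E,3ⁿ}` is onto for every `n` (Serre IV-23 with that first-order witness, p252833
  `forall_hasSurjectiveModNGaloisRep_three_pow_of_fixing_torsion_of_nonscalar`);
  `imageContainsSL2_three_of_surj_of_nine_dvd_relIndex_stabilizer` (Kato (12.5.2));
  `not_nine_dvd_relIndex_stabilizer_of_not_towerSurj` (contrapositive: on an EXOTIC row every
  scalar-closed `C ⊆ E[9]` has `9 ∤ [H : H ∩ Stab C]` for every `H` — the `I₃`-orbit of every cyclic
  `9`-subgroup has size dividing `48 · 3`, i.e. `ℚ₃(C)` has ramification index not divisible by `9`).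
* `smul_mem_zmultiples_of_mem_stabilizer` / `mem_stabilizer_of_smul_eq_zsmul` (§3) — bookkeeping
  for the cyclic case `C = ℤ·Q₀`: `σ ∈ Stab C ↔ σ Q₀ ∈ ℤ·Q₀` (and `σ⁻¹ Q₀ ∈ ℤ·Q₀`), the form in which
  a supplier of an invariant `z ∈ ℚ(C)` (a symmetric function of `x(Q₀), x(2Q₀), x(4Q₀)`, say)
  checks `Stab C`-invariance; `towerSurj_three_of_surj_of_nine_dvd_relIndex_stabilizer_zmultiples`.

This is the group half of the scalar-stabiliser criterion of the seat's m = 3 note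
(`HOME/b2b-bsdres-n1011-p02/m3/M3-LOCAL-NOTE.md` §8.1); the ramification half (an element of
`ℚ(C)` whose `3`-adic valuation has denominator divisible by `9` gives `9 ∣ [I_𝔓 : I_𝔓 ∩ Stab C]`)
is file F4a `GaloisImage/IntermediateRamificationSocket.lean`.  Nothing booked; no label change.

References: [SerreAbelianLadic1968] Ch. IV §3.4 Lemma 3 (IV-23); [Serre1972] §4.1;
[Elkies2006] arXiv:math/0612734 §1 (the exotic group meets `1 + 3M₂` in the three scalars);
[Kato2004Asterisque] (12.5.2) p. 222.
-/

noncomputable section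

open scoped Classical Pointwise
open WeierstrassCurve Literature.NumberTheory.EllipticCurves

namespace Summit.BirchSwinnertonDyer.Rank1Residual.GaloisImage

variable (W : WeierstrassCurve ℚ) [W.IsElliptic]

/-! ### §1 Scalars stabilise every scalar-closed set -/

omit [W.IsElliptic] in
/-- If every element of `H ∩ ker ρ̄_{E,3}` acts on `E[9]` as a scalar `(1 + 3m)·`, then
`H ∩ ker ρ̄_{E,3}` stabilises every set `C ⊆ E[9]` closed under these scalars (apply the scalar
property to `s` and to `s⁻¹`). [folklore] -/
theorem inf_ker_le_stabilizer_of_forall_scalar (H : Subgroup (Field.absoluteGaloisGroup ℚ))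
    {C : Set W.geomPoints} (hC9 : C ⊆ (geomTorsion W 9 : Set W.geomPoints))
    (hCsmul : ∀ m : ℕ, ∀ Q ∈ C, (1 + 3 * m) • Q ∈ C)
    (hall : ∀ s ∈ H, (∀ P ∈ geomTorsion W 3, s • P = P) →
      ∃ m : ℕ, ∀ Q ∈ geomTorsion W 9, s • Q = (1 + 3 * m) • Q) :
    (galoisRepTorsion W 3).ker ⊓ H ≤ MulAction.stabilizer (Field.absoluteGaloisGroup ℚ) C := by
  -- an element of `H ∩ ker ρ̄₃` maps `C` into `C`
  have hinto : ∀ s ∈ (galoisRepTorsion W 3).ker ⊓ H, ∀ Q ∈ C, s • Q ∈ C := by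
    intro s hs Q hQ
    have hs3 : ∀ P ∈ geomTorsion W 3, s • P = P := fun P hP ↦
      congrArg Subtype.val ((galoisRepTorsion_eq_one_iff' W 3 s).mp hs.1 ⟨P, hP⟩)
    obtain ⟨m, hm⟩ := hall s hs.2 hs3
    rw [hm Q (hC9 hQ)]
    exact hCsmul m Q hQ
  intro s hs
  rw [MulAction.mem_stabilizer_iff]
  ext Q
  rw [Set.mem_smul_set]
  constructor
  · rintro ⟨Q', hQ', rfl⟩
    exact hinto s hs Q' hQ'
  · intro hQ
    exact ⟨s⁻¹ • Q, hinto s⁻¹ (inv_mem hs) Q hQ, smul_inv_smul s Q⟩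

omit [W.IsElliptic] in
/-- Under the same all-scalar hypothesis, **`[H : H ∩ Stab C] ∣ #ρ̄_{E,3}(H)`**: the index of the
stabiliser divides the index of `H ∩ ker ρ̄₃`, which is `#ρ̄₃(H)`. [folklore] -/
theorem relIndex_stabilizer_dvd_card_map_three_of_forall_scalar
    (H : Subgroup (Field.absoluteGaloisGroup ℚ))
    {C : Set W.geomPoints} (hC9 : C ⊆ (geomTorsion W 9 : Set W.geomPoints))
    (hCsmul : ∀ m : ℕ, ∀ Q ∈ C, (1 + 3 * m) • Q ∈ C)
    (hall : ∀ s ∈ H, (∀ P ∈ geomTorsion W 3, s • P = P) →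
      ∃ m : ℕ, ∀ Q ∈ geomTorsion W 9, s • Q = (1 + 3 * m) • Q) :
    (MulAction.stabilizer (Field.absoluteGaloisGroup ℚ) C).relIndex H ∣
      Nat.card (H.map (galoisRepTorsion W 3)) := by
  have h := Subgroup.relIndex_dvd_of_le_left H
    (inf_ker_le_stabilizer_of_forall_scalar W H hC9 hCsmul hall)
  rwa [Subgroup.inf_relIndex_right, Subgroup.relIndex_ker] at h

/-! ### §2 The socket and the tower -/

/-- **SCALAR-STABILISER SOCKET.**  Let `H ≤ Γ_ℚ` and let `C ⊆ E[9]` be closed under the scalars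
`(1 + 3m)·`.  If `9 ∣ [H : H ∩ Stab C]` — the `H`-orbit of the SET `C` has size divisible by `9` —
then some `s ∈ H` fixes `E[3]` pointwise and is NOT a scalar `(1 + 3m)·` on `E[9]`: otherwise
`[H : H ∩ Stab C] ∣ #ρ̄_{E,3}(H) ∣ 48`. [folklore] -/
theorem exists_mem_fixing_three_not_scalar_nine_of_nine_dvd_relIndex_stabilizer
    (H : Subgroup (Field.absoluteGaloisGroup ℚ))
    {C : Set W.geomPoints} (hC9 : C ⊆ (geomTorsion W 9 : Set W.geomPoints))
    (hCsmul : ∀ m : ℕ, ∀ Q ∈ C, (1 + 3 * m) • Q ∈ C)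
    (h9 : 9 ∣ (MulAction.stabilizer (Field.absoluteGaloisGroup ℚ) C).relIndex H) :
    ∃ s ∈ H, (∀ P ∈ geomTorsion W 3, s • P = P) ∧
      ¬ ∃ m : ℕ, ∀ Q ∈ geomTorsion W 9, s • Q = (1 + 3 * m) • Q := by
  by_contra hnone
  push Not at hnone
  have hdvd := relIndex_stabilizer_dvd_card_map_three_of_forall_scalar W H hC9 hCsmul hnone
  exact not_nine_dvd_card_map_galoisRepTorsion_three (W := W) H (h9.trans hdvd)

/-- **THE `3`-ADIC TOWER FROM THE SCALAR-STABILISER SOCKET.**  If `ρ̄_{E,3}` is onto and for some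
`H ≤ Γ_ℚ` and some scalar-closed `C ⊆ E[9]` one has `9 ∣ [H : H ∩ Stab C]`, then `ρ̄_{E,3ⁿ}` is
onto for every `n` (Serre's lifting lemma IV-23 with the first-order witness of §2, through
`WeierstrassCurve.forall_hasSurjectiveModNGaloisRep_three_pow_of_fixing_torsion_of_nonscalar`).
[cite: SerreAbelianLadic1968, Ch. IV §3.4, Lemma 3 (IV-23)] [cite: Elkies2006, §1] -/
theorem towerSurj_three_of_surj_of_nine_dvd_relIndex_stabilizer
    (hsurj : W.HasSurjectiveModNGaloisRep 3) (H : Subgroup (Field.absoluteGaloisGroup ℚ))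
    {C : Set W.geomPoints} (hC9 : C ⊆ (geomTorsion W 9 : Set W.geomPoints))
    (hCsmul : ∀ m : ℕ, ∀ Q ∈ C, (1 + 3 * m) • Q ∈ C)
    (h9 : 9 ∣ (MulAction.stabilizer (Field.absoluteGaloisGroup ℚ) C).relIndex H) (n : ℕ) :
    W.HasSurjectiveModNGaloisRep (3 ^ n : ℕ) := by
  obtain ⟨s, -, hs3, hs9⟩ :=
    exists_mem_fixing_three_not_scalar_nine_of_nine_dvd_relIndex_stabilizer W H hC9 hCsmul h9
  exact W.forall_hasSurjectiveModNGaloisRep_three_pow_of_fixing_torsion_of_nonscalar hsurj s hs3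
    hs9 n

/-- **Kato's (12.5.2) at `3`** from surj(3) and the scalar-stabiliser socket.
[cite: Kato2004Asterisque, (12.5.2) (p. 222)] [cite: SerreAbelianLadic1968, Ch. IV §3.4, Lemma 3 (IV-23)] -/
theorem imageContainsSL2_three_of_surj_of_nine_dvd_relIndex_stabilizer
    (hsurj : W.HasSurjectiveModNGaloisRep 3) (H : Subgroup (Field.absoluteGaloisGroup ℚ))
    {C : Set W.geomPoints} (hC9 : C ⊆ (geomTorsion W 9 : Set W.geomPoints))
    (hCsmul : ∀ m : ℕ, ∀ Q ∈ C, (1 + 3 * m) • Q ∈ C)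
    (h9 : 9 ∣ (MulAction.stabilizer (Field.absoluteGaloisGroup ℚ) C).relIndex H) :
    Kato2004.ImageContainsSL2 W 3 := by
  haveI : Fact (Nat.Prime 3) := ⟨Nat.prime_three⟩
  exact (Kato2004.imageContainsSL2_iff_forall_hasSurjectiveModNGaloisRep W 3).mpr
    (towerSurj_three_of_surj_of_nine_dvd_relIndex_stabilizer W hsurj H hC9 hCsmul h9)

/-- **On an EXOTIC row every scalar-closed `C ⊆ E[9]` has an orbit of size NOT divisible by `9`**
(under every `H ≤ Γ_ℚ`): if `ρ̄_{E,3}` is onto and the `3`-adic tower fails at some level, then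
`9 ∤ [H : H ∩ Stab C]` — e.g. the field `ℚ₃(C)` cut out by a cyclic `9`-subgroup `C` has
ramification index not divisible by `9`.  (Type-E / Elkies rows: every such index divides `48·3`.)
[cite: Elkies2006, §1] -/
theorem not_nine_dvd_relIndex_stabilizer_of_not_towerSurj
    (hsurj : W.HasSurjectiveModNGaloisRep 3)
    (hnot : ¬ ∀ n : ℕ, W.HasSurjectiveModNGaloisRep (3 ^ n : ℕ))
    (H : Subgroup (Field.absoluteGaloisGroup ℚ))
    {C : Set W.geomPoints} (hC9 : C ⊆ (geomTorsion W 9 : Set W.geomPoints))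
    (hCsmul : ∀ m : ℕ, ∀ Q ∈ C, (1 + 3 * m) • Q ∈ C) :
    ¬ 9 ∣ (MulAction.stabilizer (Field.absoluteGaloisGroup ℚ) C).relIndex H := fun h9 ↦
  hnot (towerSurj_three_of_surj_of_nine_dvd_relIndex_stabilizer W hsurj H hC9 hCsmul h9)

/-! ### §3 The cyclic case `C = ℤ·Q₀` -/

omit [W.IsElliptic] in
/-- The multiples `ℤ·Q₀` of a point `Q₀ ∈ E[9]` lie in `E[9]`. [folklore] -/
theorem zmultiples_subset_geomTorsion_nine {Q₀ : W.geomPoints} (hQ₀ : Q₀ ∈ geomTorsion W 9) :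
    ((AddSubgroup.zmultiples Q₀ : AddSubgroup W.geomPoints) : Set W.geomPoints) ⊆
      (geomTorsion W 9 : Set W.geomPoints) := by
  intro Q hQ
  exact (AddSubgroup.zmultiples_le_of_mem hQ₀) hQ

omit [W.IsElliptic] in
/-- `ℤ·Q₀` is closed under the scalars `(1 + 3m)·` (under every natural scalar). [folklore] -/
theorem nsmul_mem_zmultiples_of_mem (Q₀ : W.geomPoints) (m : ℕ) (Q : W.geomPoints)
    (hQ : Q ∈ ((AddSubgroup.zmultiples Q₀ : AddSubgroup W.geomPoints) : Set W.geomPoints)) :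
    (1 + 3 * m) • Q ∈ ((AddSubgroup.zmultiples Q₀ : AddSubgroup W.geomPoints) : Set W.geomPoints) :=
  AddSubgroup.nsmul_mem _ hQ _

omit [W.IsElliptic] in
/-- **`σ ∈ Stab(ℤ·Q₀)` ⟹ `σ Q₀ ∈ ℤ·Q₀`** — the usable direction: an invariant of `(E, ℤ·Q₀)`
that is fixed by every `σ` with `σ Q₀ = k·Q₀` for some `k` is fixed by `Stab(ℤ·Q₀)`. [folklore] -/
theorem smul_mem_zmultiples_of_mem_stabilizer {Q₀ : W.geomPoints}
    {σ : Field.absoluteGaloisGroup ℚ}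
    (hσ : σ ∈ MulAction.stabilizer (Field.absoluteGaloisGroup ℚ)
      (((AddSubgroup.zmultiples Q₀ : AddSubgroup W.geomPoints) : Set W.geomPoints))) :
    ∃ k : ℤ, σ • Q₀ = k • Q₀ := by
  rw [MulAction.mem_stabilizer_iff] at hσ
  have hmem : σ • Q₀ ∈ ((AddSubgroup.zmultiples Q₀ : AddSubgroup W.geomPoints) : Set W.geomPoints) := by
    rw [← hσ]
    exact Set.smul_mem_smul_set (AddSubgroup.mem_zmultiples Q₀)
  obtain ⟨k, hk⟩ := AddSubgroup.mem_zmultiples_iff.mp hmem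
  exact ⟨k, hk.symm⟩

omit [W.IsElliptic] in
/-- **`σ Q₀ = k·Q₀` with `σ⁻¹ Q₀ = k'·Q₀` ⟹ `σ ∈ Stab(ℤ·Q₀)`** (Galois acts by group
automorphisms, so `σ (j·Q₀) = j·(σ Q₀)`). [folklore] -/
theorem mem_stabilizer_of_smul_eq_zsmul {Q₀ : W.geomPoints} {σ : Field.absoluteGaloisGroup ℚ}
    {k k' : ℤ} (hk : σ • Q₀ = k • Q₀) (hk' : σ⁻¹ • Q₀ = k' • Q₀) :
    σ ∈ MulAction.stabilizer (Field.absoluteGaloisGroup ℚ)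
      (((AddSubgroup.zmultiples Q₀ : AddSubgroup W.geomPoints) : Set W.geomPoints)) := by
  -- `τ (j·Q₀) = j·(τ Q₀)` for every `τ ∈ Γ_ℚ`
  have hlin : ∀ (τ : Field.absoluteGaloisGroup ℚ) (j : ℤ), τ • (j • Q₀) = j • (τ • Q₀) :=
    fun τ j ↦ smul_comm τ j Q₀
  have hinto : ∀ (τ : Field.absoluteGaloisGroup ℚ) (l : ℤ), τ • Q₀ = l • Q₀ →
      ∀ Q ∈ ((AddSubgroup.zmultiples Q₀ : AddSubgroup W.geomPoints) : Set W.geomPoints),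
        τ • Q ∈ ((AddSubgroup.zmultiples Q₀ : AddSubgroup W.geomPoints) : Set W.geomPoints) := by
    intro τ l hl Q hQ
    obtain ⟨j, rfl⟩ := AddSubgroup.mem_zmultiples_iff.mp hQ
    rw [hlin, hl, ← mul_smul]
    exact AddSubgroup.mem_zmultiples_iff.mpr ⟨j * l, rfl⟩
  rw [MulAction.mem_stabilizer_iff]
  ext Q
  rw [Set.mem_smul_set]
  constructor
  · rintro ⟨Q', hQ', rfl⟩
    exact hinto σ k hk Q' hQ'
  · intro hQ
    exact ⟨σ⁻¹ • Q, hinto σ⁻¹ k' hk' Q hQ, smul_inv_smul σ Q⟩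

/-- **THE TOWER, CYCLIC FORM.**  If `ρ̄_{E,3}` is onto, `Q₀ ∈ E[9]`, and for some `H ≤ Γ_ℚ` the
stabiliser of `ℤ·Q₀` has `9 ∣ [H : H ∩ Stab(ℤ·Q₀)]` (the `H`-orbit of the cyclic subgroup `ℤ·Q₀` has
size divisible by `9`), then `ρ̄_{E,3ⁿ}` is onto for every `n`.
[cite: SerreAbelianLadic1968, Ch. IV §3.4, Lemma 3 (IV-23)] [cite: Elkies2006, §1] -/
theorem towerSurj_three_of_surj_of_nine_dvd_relIndex_stabilizer_zmultiples
    (hsurj : W.HasSurjectiveModNGaloisRep 3) (H : Subgroup (Field.absoluteGaloisGroup ℚ))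
    {Q₀ : W.geomPoints} (hQ₀ : Q₀ ∈ geomTorsion W 9)
    (h9 : 9 ∣ (MulAction.stabilizer (Field.absoluteGaloisGroup ℚ)
      (((AddSubgroup.zmultiples Q₀ : AddSubgroup W.geomPoints) : Set W.geomPoints))).relIndex H)
    (n : ℕ) : W.HasSurjectiveModNGaloisRep (3 ^ n : ℕ) :=
  towerSurj_three_of_surj_of_nine_dvd_relIndex_stabilizer W hsurj H
    (zmultiples_subset_geomTorsion_nine W hQ₀) (nsmul_mem_zmultiples_of_mem W Q₀) h9 n

end Summit.BirchSwinnertonDyer.Rank1Residual.GaloisImage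

end
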